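import Literature.AlgebraicGeometry.HodgeTheory.SupportedHodgeClassDescent
import Literature.AlgebraicGeometry.HodgeTheory.ThomGysinClosedImmersion
import Literature.AlgebraicGeometry.HodgeTheory.SupportedClassesIrreducible
import Literature.AlgebraicGeometry.HodgeTheory.ComplexGysinHodgeType
import Literature.AlgebraicGeometry.HodgeTheory.HodgeFiltrationModelsReductionProofs
import Literature.AlgebraicGeometry.HodgeTheory.ComplexConjugationHolds
import Literature.AlgebraicGeometry.HodgeTheory.SupportedClassesHodgeConiveau
import Literature.NumberTheory.Transcendental.DeRhamTheoremMultiplicative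
import Literature.AlgebraicGeometry.Resolution.ProjectiveResolutionProofs
import Summits.HodgeConjecture.HodgeConjecture.Theorems.AmpleAdicLefschetzAlgebraicClassesHodgeTypeBump
import Summits.HodgeConjecture.HodgeConjecture.Theorems.AmpleAdicLefschetzAlgebraicClassesHodgeTypeCech
import Summits.HodgeConjecture.HodgeConjecture.Theorems.AmpleAdicLefschetzAlgebraicClassesHodgeTypeResolution

/-!
# Route AmpleAdicLefschetz — `AlgebraicClassesHodgeType` (item stmt-HodgeConjecture-15189):
# algebraic classes are of Hodge type `(p, p)` in every Hodge model

For `X` smooth projective of dimension `n` over `ℂ`, every Hodge model `A` of `X`, every `p` and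
every `c ∈ algebraicClasses X p = Nᵖ H²ᵖ(X(ℂ); ℂ)`, the pull-back `A.pullback (2p) c` lies in
`A.hodgePQ (2p) p p` — "the class of an algebraic cycle is of type `(p, p)`" (Deligne 2000, §1;
Voisin I, Prop. 11.20).  UNCONDITIONAL: no named facts enter.

Proof.  `Nᵖ H²ᵖ(X(ℂ); ℂ)` is the sum, over the irreducible closed `V ⊆ X` whose generic point has
codimension exactly `p`, of `K_V = ker (H²ᵖ(X(ℂ)) → H²ᵖ((X ∖ V)(ℂ)))`
(`algebraicClasses_eq_iSup_coheight_genericPoint_eq`, purity/semipurity).  For `p = 0` every class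
of `H⁰` is of type `(0, 0)` (`HodgeModel.hodgeConiveau_zero`).  For `p ≥ 1`,
`ker_restrictCompl_le_range_complexGysin_of_isIrreducible` (parts 2–4: Hironaka, GAGA straightening, a
Pontryagin–Thom bump class, Čech–Alexander duality and the purity line, Deligne's duality
transposition) gives `K_V ≤ ℂ · g_* 1` for a resolution `g : Ỹ → V ⊆ X`, `dim Ỹ = n - p`, and the
Gysin morphism `g_*` has bidegree `(p, p)` (`isOfHodgeType_complexGysin`, Voisin I §7.3.2, from the
tree's proved de Rham theorem, Hodge decomposition and independence of the Hodge model), so `K_V`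
consists of classes of type `(p, p)`; the Hodge type may be read in any model
(`hodgePQ_independent_of_hodgeModel_holds`).

Main results: `algebraicClasses_pullback_mem_hodgePQ` (the item, binder for binder) and
`isOfHodgeType_of_mem_algebraicClasses'` (the `IsOfHodgeType` form consumed across the Hodge routes).
-/

set_option linter.dupNamespace false

noncomputable section

open scoped Manifold
open CategoryTheory AlgebraicGeometry
open Literature.AlgebraicGeometry Literature.AlgebraicGeometry.Motives
open Literature.AlgebraicGeometry.HodgeTheory
open Literature.AlgebraicTopology.SingularHomology

namespace Summit.HodgeConjecture.HodgeConjecture.Theorems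

variable {n : ℕ} {X : Motives.SchemeOver ℂ}

/-- **The classes supported on ONE irreducible subvariety of codimension `p ≥ 1` are multiples of
the Gysin class of a resolution** (Deligne, Hodge III, Cor. 8.2.8, top degree, one irreducible
subvariety; Fulton 1998 §19.1, `H²ᵖ(X, X − V) = ℂ · cl(V)`, `cl(V) = g_* [Ỹ]`): for `X` smooth
projective of dimension `n` over `ℂ`, `V ⊆ X` Zariski-closed irreducible with every point of
codimension `≥ p ≥ 1` and generic point of codimension `p`, there is `g : Y ⟶ X` from a smooth
projective `Y` of dimension `d`, `p + d = n`, with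
`ker (H²ᵖ(X(ℂ); ℂ) → H²ᵖ((X ∖ V)(ℂ); ℂ)) ≤ im (g_* : H⁰(Y(ℂ); ℂ) → H²ᵖ(X(ℂ); ℂ))` for the
Gysin morphism of any orientation family `μ`. Proof in the module docstring.
[cite: DeligneHodgeIII1974, Prop. 8.2.7 and Cor. 8.2.8] [cite: Fulton1998, §19.1 Lemma 19.1.1 and Lemma 19.1.2] -/
theorem ker_restrictCompl_le_range_complexGysin_of_isIrreducible (μ : OrientationFamily)
    (hX : IsSmoothProjective n X) {V : Set X.left} (hVc : IsClosed V)
    (hVi : IsIrreducible V) {p : ℕ} (hp : 1 ≤ p)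
    (hVl : ∀ v ∈ V, (p : ℕ∞) ≤ Order.coheight v)
    (hgen : Order.coheight hVi.genericPoint = p) :
    ∃ (d : ℕ) (Y : SchemeOver ℂ) (hY : IsSmoothProjective d Y) (g : Y ⟶ X)
      (hab : 0 + 2 * n = 2 * p + 2 * d),
      LinearMap.ker (complexBetti.restrictCompl X V (2 * p)).hom ≤
        LinearMap.range (complexGysin μ hY hX g hab) := by
  obtain ⟨d, Y, hY, g, O, hpd, hO, hηO, hgrange, hemb, himage⟩ :=
    exists_resolution_isEmbedding hX hVc hVi hgen
  have hab : 0 + 2 * n = 2 * p + 2 * d := by omega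
  refine ⟨d, Y, hY, g, hab, ?_⟩
  set gc := AlgPoints.mapContinuous (L := ℂ) g with hgc
  have hfT : ∀ z : ComplexPoints Y, (gc z).pt ∈ V := fun z ↦ by
    rw [← hgrange]
    exact ⟨z.pt, rfl⟩
  -- Prop. 8.2.7 in Čech form in the top degree `q = 2d`, for the single morphism `g`
  have H : ∀ x' : complexBetti X (2 * d), complexBetti.map g (2 * d) x' = 0 →
      ∃ W : Set (ComplexPoints X), IsOpen W ∧ {P : ComplexPoints X | P.pt ∈ V} ⊆ W ∧
        singularCohomology.map ℂ ℂ (subsetIncl W) (2 * d) x' = 0 := by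
    intro x' hx'
    -- the manifolds `X(ℂ)`, `Y(ℂ)` and an orientation of `Y(ℂ)`
    letI := hX.chartedSpace
    haveI := ComplexPoints.t2Space_of_isSmoothProjective hX
    letI := hY.chartedSpace
    haveI := ComplexPoints.compactSpace_of_isSmoothProjective hY
    haveI := ComplexPoints.t2Space_of_isSmoothProjective hY
    obtain ⟨ν⟩ := ComplexPoints.isOrientableOver ℂ hY
    -- a straightened point `b ∈ V(ℂ) ∩ O(ℂ)` (GAGA straightening off a closed `Z₁` of larger
    -- codimension; complex points are dense in the non-empty locally closed `V ∩ O ∖ Z₁`)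
    haveI := hX.smoothOfRelativeDimension
    haveI : LocallyOfFiniteType X.hom := by
      haveI : Smooth X.hom := SmoothOfRelativeDimension.smooth n _
      infer_instance
    obtain ⟨Z₁, hZ₁, -, hcZ₁, hstr⟩ := GAGADimension.exists_closed_straightening_off hX hVc hVl
    have hηZ₁ : hVi.genericPoint ∉ Z₁ := fun h ↦ by
      have h1 := hcZ₁ _ h
      rw [hgen] at h1
      have h2 : p + 1 ≤ p := by exact_mod_cast h1
      omega
    obtain ⟨b, hb⟩ := ComplexPoints.exists_pt_mem (X := X) (Z := (V ∩ O) ∩ Z₁ᶜ)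
      ⟨hVi.genericPoint, ⟨(hVi.isGenericPoint_genericPoint hVc).mem, hηO⟩, hηZ₁⟩
      ((hVc.isLocallyClosed.inter hO.isLocallyClosed).inter hZ₁.isOpen_compl.isLocallyClosed)
    obtain ⟨c', K, e, -, hbe, he⟩ := hstr b hb.1.1 hb.2
    have hOc : IsOpen {P : ComplexPoints X | P.pt ∈ O} :=
      Motives.AlgPoints.isOpen_setOf_pt_mem (X := X) (L := ℂ) ⟨O, hO⟩
    -- the bump class (part 2) and the Čech argument (part 3)
    obtain ⟨W₁, hW₁, hTW₁, hW, η, hη⟩ := exists_bump_class (M := ComplexPoints X)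
      (N := ComplexPoints Y) ν (F := Fin c' → ℂ) (K := ↥K) gc {P : ComplexPoints X | P.pt ∈ V} hfT
      e he {P : ComplexPoints X | P.pt ∈ O} hOc (gc ⁻¹' {P : ComplexPoints X | P.pt ∈ O}) hemb
      himage (fun _ h ↦ h) b hb.1.1 hb.1.2 hbe
    exact exists_isOpen_map_subsetIncl_eq_zero_of_bump hX hVc hVi hp hVl g hpd hW₁ hTW₁ hfT hW η
      hη x' hx'
  -- Deligne's transposition by Poincaré duality (the tree's Cor. 8.2.8 from Prop. 8.2.7)
  have key := ker_restrictCompl_le_iSup_range_complexGysin_of_pullback μ hX (ι := Unit)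
    (m := fun _ ↦ d) (Y := fun _ ↦ Y) (fun _ ↦ hY) (fun _ ↦ g) (b := 2 * p) (q := 2 * d)
    (by omega) (fun x' hx' ↦ by
      obtain ⟨W, hWo, hVW, h0⟩ := H x' (hx' ())
      refine ⟨W, hWo, fun P hP ↦ hVW ?_, h0⟩
      obtain ⟨j, hj⟩ := Set.mem_iUnion.1 (show P.pt ∈ ⋃ _ : Unit, Set.range g.left.base from hP)
      change P.pt ∈ V
      rw [← hgrange]
      exact hj)
  refine (ker_restrictCompl_le_of_subset ?_ (2 * p)).trans (key.trans ?_)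
  · intro v hv
    exact Set.mem_iUnion.2 ⟨(), show v ∈ Set.range g.left.base by rw [hgrange]; exact hv⟩
  · refine iSup_le fun j ↦ iSup_le fun a ↦ iSup_le fun hab' ↦ ?_
    obtain rfl : a = 0 := by omega
    exact le_rfl

/-- Every class of `H⁰(Y(ℂ); ℂ)` is of Hodge type `(0, 0)`: `H⁰` of a Hodge model is the single
piece `H^{0,0}` of its Hodge decomposition (`HodgeModel.hodgeConiveau_zero`). -/
theorem isOfHodgeType_zero {m : ℕ} {Y : Motives.SchemeOver ℂ} (hY : Motives.IsSmoothProjective m Y)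
    (y : complexBetti Y 0) : IsOfHodgeType m Y 0 0 0 y := by
  obtain ⟨B⟩ := (nonempty_hodgeModel_holds (n := m) (X := Y)).nonempty hY
  refine ⟨B, ?_⟩
  have h : B.pullback 0 y ∈ B.hodgeConiveau 0 0 := by
    rw [B.hodgeConiveau_zero]
    exact Submodule.mem_top
  have hle : B.hodgeConiveau 0 0 ≤ B.hodgePQ 0 0 0 := by
    refine iSup_le fun a => iSup_le fun b => iSup_le fun hab => iSup_le fun _ => iSup_le fun _ => ?_
    obtain ⟨rfl, rfl⟩ : a = 0 ∧ b = 0 := by omega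
    exact le_rfl
  exact hle h

/-- Classes of a fixed Hodge type `(p, q)` on a smooth projective `X` form a subspace: in one
(any) Hodge model `A` they are the preimage of `H^{p,q}` (`hodgePQ_independent_of_hodgeModel_holds`). -/
theorem isOfHodgeType_iff_mem_comap (hX : Motives.IsSmoothProjective n X) (A : HodgeModel n X)
    {k p q : ℕ} (c : complexBetti X k) :
    IsOfHodgeType n X k p q c ↔ c ∈ (A.hodgePQ k p q).comap (A.pullback k).hom :=
  hodgePQ_independent_of_hodgeModel_holds.isOfHodgeType_iff hX A

/-- **The classes supported on ONE irreducible subvariety of codimension `p ≥ 1` are of Hodge type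
`(p, p)`**: they are multiples of the Gysin image `g_* 1` of a resolution `g : Ỹ → X` of the
subvariety (`ker_restrictCompl_le_range_complexGysin_of_isIrreducible`), `1 ∈ H⁰(Ỹ(ℂ))` is of
type `(0, 0)` and Gysin morphisms have bidegree `(p, p)` (`isOfHodgeType_complexGysin`, Voisin I
§7.3.2). -/
theorem ker_restrictCompl_le_comap_hodgePQ_of_isIrreducible (hX : Motives.IsSmoothProjective n X)
    (A : HodgeModel n X) {V : Set X.left} (hVc : IsClosed V) (hVi : IsIrreducible V) {p : ℕ}
    (hp : 1 ≤ p) (hVl : ∀ v ∈ V, (p : ℕ∞) ≤ Order.coheight v)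
    (hgen : Order.coheight hVi.genericPoint = p) :
    LinearMap.ker (complexBetti.restrictCompl X V (2 * p)).hom ≤
      (A.hodgePQ (2 * p) p p).comap (A.pullback (2 * p)).hom := by
  let μ : OrientationFamily := fun _ _ hY ↦ (Motives.ComplexPoints.isOrientableOver ℂ hY).some
  obtain ⟨d, Y, hY, g, hab, hle⟩ :=
    ker_restrictCompl_le_range_complexGysin_of_isIrreducible μ hX hVc hVi hp hVl hgen
  refine hle.trans ?_
  rintro _ ⟨y, rfl⟩
  rw [← isOfHodgeType_iff_mem_comap hX A]
  exact isOfHodgeType_complexGysin hodgePQ_independent_of_hodgeModel_holds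
    (fun m Y ↦ nonempty_hodgeModel_holds) (fun E _ _ _ ↦
      Literature.NumberTheory.Transcendental.exists_deRhamIsoFamily_holds E) μ hY hX g hab
    (p := 0) (q := 0) (by omega) (by omega) (isOfHodgeType_zero hY y)

/-- **Algebraic classes are of Hodge type `(p, p)` in every Hodge model.** For `X` smooth projective
of dimension `n` over `ℂ`, every Hodge model `A` of `X`, every `p` and every
`c ∈ algebraicClasses X p = Nᵖ H²ᵖ(X(ℂ); ℂ)`, the pull-back `A.pullback (2p) c` lies in
`A.hodgePQ (2p) p p` (Deligne 2000 §1, "the class of an algebraic cycle is of type `(p, p)`";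
Voisin I Prop. 11.20). Proof: `Nᵖ H²ᵖ` is the sum over the irreducible closed `V` with generic
point of codimension exactly `p` of `ker (H²ᵖ(X(ℂ)) → H²ᵖ((X ∖ V)(ℂ)))`
(`algebraicClasses_eq_iSup_coheight_genericPoint_eq`); for `p = 0` every class of `H⁰` is of type
`(0, 0)`; for `p ≥ 1` each kernel consists of `(p, p)`-classes
(`ker_restrictCompl_le_comap_hodgePQ_of_isIrreducible`). -/
theorem algebraicClasses_pullback_mem_hodgePQ (hX : Motives.IsSmoothProjective n X)
    (A : HodgeModel n X) (p : ℕ) {c : complexBetti X (2 * p)} (hc : c ∈ algebraicClasses X p) :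
    A.pullback (2 * p) c ∈ A.hodgePQ (2 * p) p p := by
  rcases Nat.eq_zero_or_pos p with rfl | hp
  · have h0 := (isOfHodgeType_iff_mem_comap hX A c).1 (isOfHodgeType_zero hX c)
    simpa using h0
  change c ∈ (A.hodgePQ (2 * p) p p).comap (A.pullback (2 * p)).hom
  rw [algebraicClasses_eq_iSup_coheight_genericPoint_eq hX p] at hc
  have hle : (⨆ (V : Set X.left) (_ : IsClosed V) (hV : IsIrreducible V)
      (_ : ∀ v ∈ V, (p : ℕ∞) ≤ Order.coheight v) (_ : Order.coheight hV.genericPoint = p),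
        LinearMap.ker (complexBetti.restrictCompl X V (2 * p)).hom) ≤
      (A.hodgePQ (2 * p) p p).comap (A.pullback (2 * p)).hom :=
    iSup_le fun V ↦ iSup_le fun hVc ↦ iSup_le fun hVi ↦ iSup_le fun hVl ↦ iSup_le fun hgen ↦
      ker_restrictCompl_le_comap_hodgePQ_of_isIrreducible hX A hVc hVi hp hVl hgen
  exact hle hc

/-- **Algebraic classes are of Hodge type `(p, p)`** (`IsOfHodgeType` form, unconditional): for
`X` smooth projective over `ℂ` and `c ∈ algebraicClasses X p`, `IsOfHodgeType n X (2p) p p c` —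
the statement taken as hypothesis `hG`/`Grothendieck1969_supportedClasses_le_hodgeConiveau` in
several Hodge routes, now a theorem. [cite: Deligne2000, §1] [cite: VoisinHodgeI2002, Prop. 11.20] -/
theorem isOfHodgeType_of_mem_algebraicClasses' (hX : Motives.IsSmoothProjective n X) {p : ℕ}
    {c : complexBetti X (2 * p)} (hc : c ∈ algebraicClasses X p) :
    IsOfHodgeType n X (2 * p) p p c := by
  obtain ⟨A⟩ := (nonempty_hodgeModel_holds (n := n) (X := X)).nonempty hX
  exact ⟨A, algebraicClasses_pullback_mem_hodgePQ hX A p hc⟩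

end Summit.HodgeConjecture.HodgeConjecture.Theorems

end
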